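import Summits.QuantumFields.BalabanUV.Beta.WardLocusStencils
import Summits.QuantumFields.BalabanUV.Beta.FP.TorusGaugeCovariancePairing

/-!
# `BalabanUV.Beta.FP.PeriodisedLamFoldPureGauge` — road «FP» (binder row D1), ROUTE T, SPEC-50 §C (J-Λ-X), TORUS LETTER:
# **THE INDEX-PERIODISED Λ-FOLD KILLS EVERY TORUS PURE GAUGE** — for every kernel `A` decaying at a positive rate, every box `M`, every torus gauge function
# `λ : pbox M → ℝ` and every multiplier slot `(κ, s)`:  `Σ_{b : pbox M × Fin (d+1)} (Σ_t tgrad M (b.1, inl b.2) t · λ t) · Λ̂ b.2 b.1 = 0`,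
# `Λ̂ l u := Σ'_m lamCoeffOf A N κ s l (translate M u m)` (leaf-10's pointwise Λ-null `WardLocusStencils.sum_lamCoeffOf_div_eq_zero`, periodised)

WHY (located).  Road FP g39's SPEC-50 §C words the Λ-sector's behaviour along the exact part of the one-shot column ((J-Λ-X), after R-FP-79) as the
concrete question «does the straight chart's Λ-fold kill exact directions: `Σ_b (Σ_t tgrad T (b.1, inl b.2) t · λ t) · lamCoeffOf (KInv N) N κ s b.2 b.1 = 0`
for every torus gauge function `λ` (periodised as in K1)?».  The LATTICE half is leaf-10's (W-LS0-Λ) `sum_lamCoeffOf_div_eq_zero` — for EVERY kernel `A`,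
`Σ_κ′ (lamCoeffOf A N μ y κ′ (u − e_κ′) − lamCoeffOf A N μ y κ′ u) = 0` (the multiplier sees the fine source only through the flat Wilson column, and
`d*d ∘ d = 0`).  THIS FILE is the TORUS half: periodise the fold in its fine index over the box lattice `Mℤ^{d+1}` (absolutely convergent by the decay of `A`,
lit `abs_lamCoeffOf_le`), read the torus gradient `tgrad` against `λ` as the lattice gradient of the periodic extension `λ ∘ wrapPt` (`sum_tdelta_mul`), sum by
parts on the finite torus, and apply the pointwise null under the period sum.  The answer to SPEC-50 §C's question is YES, for every decaying `A` (in
particular `KInv N` and the row's `AN (Roots.ctr Lc) (n+1)`): the contracted multiplier response is BLIND to the exact part `tgrad·λ̂θ` of the one-shot column,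
so (J-Λ) may be stated along `hv(dv)` or along `colN` indifferently and (J-X) alone carries #21's commutator.

WHAT ([folklore] `tsum` bookkeeping + finite summation by parts BY NAME; no `def`, no `def … : Prop`, nothing cited, 0 sorry): §1 `summable_lamCoeffOf_translate`
(the period sum converges), `tsum_lamCoeffOf_translate_translate` (the periodised fold is `M`-periodic), `tsum_lamCoeffOf_translate_wrap` (hence blind to `wrap`),
**`sum_tsum_lamCoeffOf_translate_div_eq_zero`** (zero fine divergence on the torus: leaf-10's null under the period sum); §2 `sum_tgrad_mul_eq_sub` (the torus gradient
against `λ` is `λ(wrapPt (y+e_l)) − λ(wrapPt y)`), `sum_pbox_ite_wrapPt_add_eq` (re-indexing the finite torus by a unit shift), **`sum_tgrad_mul_periodisedLamFold_eq_zero`**.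
WHAT THIS IS NOT: not (J-Λ) ∕ (J-Λ-X) at the wrapper (the road's instantiation: WHICH weight `cf` and the link presentation — SPEC-50 §C), not the Λ-STENCIL family
version (`SLam N (lamCoeffOf A N) Q2` inserted along `tgrad·λ` — the twin of leaf-05 g27's `PeriodisedFormIndexWard.torus_form_pureGauge_of_box` with `q := 0`; it
follows from this fold identity entry by entry once the `Q2`-table sum is exchanged, not done here); no row of the END wrapper discharged; 0 estimates; nothing
of Bałaban's asserted, valued or discharged; 0∕4 row-D1 binders (hW, hR, D1Tel, D1Rep); ROOT M‴ p325680 untouched; NOT (C1), NOT (L2′), NOT (T-ID), NOT SDF,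
NOT D1, NEVER «G-an2-4 closed», NOT BetaPertH, NOT continuum, NOT Clay.

HONEST DEPENDENCY (page 1, mandatory): continuum YM on T⁴ ⇐ BetaPertH ∧ nine spine estimates (0/9 proved); BetaPertH ⇐ (D1) ∧ (D4) ∧ CAP+tail;
G-an2-4 gates asym, D1 and NE2/3/4.  HONEST FRAMING (cell contract, verbatim): «discharging `BetaPertH` makes Bałaban's UV stability UNCONDITIONAL —
a real constructive-QFT result; it is NOT the continuum limit and NOT the Clay problem.»  ABSOLUTE RULE (cell charter, verbatim): «No internally-minted
statement may enter as a cited fact. Every hypothesis is either kernel-proved in this package or a verbatim quotation of a PUBLISHED theorem with page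
reference. The manuscript(s) under audit are NOT citable for their own disputed steps — they are the thing under adjudication; programme-internal
(2001/route/tribunal) claims are never citable.»  D1 formalisation swarm LEAF PROVER 03 (b2b-balaban-beta-d1-formalise-leaf-03 gen 56), 2026-08-27.  No existing file touched.
-/

noncomputable section

open scoped BigOperators

namespace Summit.QuantumFields.BalabanUV.Beta.FP.PeriodisedLamFoldPureGauge

open Finset
open Literature.MathematicalPhysics.QuantumFieldTheory.Balaban1983to89
open Literature.MathematicalPhysics.QuantumFieldTheory.Balaban1983to89.Beta
open B4TorusKernel.MultiPeriod (translate translate_apply translate_injective)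
open B4Reflection242 (translate_translate)
open B6Lemma24Torus (pbox wrap wrap_eq_self wrap_wrap_add)
open Summit.QuantumFields.BalabanUV.Beta.GAN24.KernelPeriodisation (quo translate_wrap_quo)
open AffineAveraging (Site unitVec)
open ExpKernelCalculus (MKer Decays l1_sub_symm)
open OneStepResolventKernel (Fib)
open BalabanStepJets (lamCoeffOf abs_lamCoeffOf_le)
open KKTFluctuationEnergy (summable_of_exp_bound)
open Summit.QuantumFields.BalabanUV.Beta.WardLocusStencils (sum_lamCoeffOf_div_eq_zero)
open Summit.QuantumFields.BalabanUV.Beta.FP.TorusGaugeCovariance (tdelta tgrad tgrad_inl)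
open Summit.QuantumFields.BalabanUV.Beta.FP.TorusGaugeCovariancePairing (wrapPt wrapPt_coe wrapPt_of_mem sum_tdelta_mul)

variable {d : ℕ}

/-! ## §1 The index-periodised Λ-fold: convergence, periodicity, zero fine divergence -/

section Fold

variable (M : Fin (d + 1) → ℕ) [∀ μ, NeZero (M μ)] {A : MKer (d + 1) (Fib d)} {C δ : ℝ} (hA : Decays A C δ) (hC : 0 ≤ C) (hδ : 0 < δ)
  (N : ℕ) (κ : Fin (d + 1)) (s : Site (d + 1))
include hA hC hδ

/-- [folklore] **the period sum of the Λ-fold converges**: `m ↦ lamCoeffOf A N κ s l (translate M u m)` is summable (lit `abs_lamCoeffOf_le`: exponential decay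
of the fold in its fine index from `N•s`, summable over `ℤ^{d+1}` by `summable_of_exp_bound`, restricted along the injective `translate M u`). -/
theorem summable_lamCoeffOf_translate (l : Fin (d + 1)) (u : Site (d + 1)) :
    Summable fun m : Site (d + 1) => lamCoeffOf A N κ s l (translate M u m) := by
  have hall : Summable fun w : Site (d + 1) => lamCoeffOf A N κ s l w :=
    summable_of_exp_bound hδ ((N : ℤ) • s) fun w => by
      have h := abs_lamCoeffOf_le (N := N) hA hC hδ.le κ s l w
      rw [l1_sub_symm] at h
      exact h
  exact hall.comp_injective (translate_injective (fun i => Nat.one_le_iff_ne_zero.mpr (NeZero.ne (M i))) u)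

omit [∀ μ, NeZero (M μ)] hA hC hδ in
/-- [folklore] **the periodised fold is `M`-periodic**: `Λ̂ l (translate M u m₀) = Λ̂ l u` (`translate_translate`, re-index `m ↦ m₀ + m`; no convergence needed). -/
theorem tsum_lamCoeffOf_translate_translate (l : Fin (d + 1)) (u m₀ : Site (d + 1)) :
    (∑' m : Site (d + 1), lamCoeffOf A N κ s l (translate M (translate M u m₀) m))
      = ∑' m : Site (d + 1), lamCoeffOf A N κ s l (translate M u m) := by
  simp only [translate_translate]
  exact (Equiv.addLeft m₀).tsum_eq fun m => lamCoeffOf A N κ s l (translate M u m)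

omit [∀ μ, NeZero (M μ)] hA hC hδ in
/-- [folklore] **… hence blind to `wrap`**: `Λ̂ l (wrap M x) = Λ̂ l x` (`x` is a translate of `wrap M x`: GAN24 `KernelPeriodisation.translate_wrap_quo`; no convergence needed). -/
theorem tsum_lamCoeffOf_translate_wrap (l : Fin (d + 1)) (x : Site (d + 1)) :
    (∑' m : Site (d + 1), lamCoeffOf A N κ s l (translate M (wrap M x) m))
      = ∑' m : Site (d + 1), lamCoeffOf A N κ s l (translate M x m) := by
  conv_rhs => rw [← translate_wrap_quo M x]
  exact (tsum_lamCoeffOf_translate_translate M N κ s l (wrap M x) (quo M x)).symm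

/-- [folklore] **`sum_tsum_lamCoeffOf_translate_div_eq_zero` — ZERO FINE DIVERGENCE ON THE TORUS**: for every site `t`,
`Σ_l (Λ̂ l (t − e_l) − Λ̂ l t) = 0` — leaf-10's pointwise null `sum_lamCoeffOf_div_eq_zero` at every translate `translate M t m`, under the convergent period sum
(`translate M (t − e_l) m = translate M t m − e_l`). -/
theorem sum_tsum_lamCoeffOf_translate_div_eq_zero (t : Site (d + 1)) :
    ∑ l : Fin (d + 1), ((∑' m : Site (d + 1), lamCoeffOf A N κ s l (translate M (t - unitVec l) m))
      - ∑' m : Site (d + 1), lamCoeffOf A N κ s l (translate M t m)) = 0 := by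
  have hs₁ : ∀ l : Fin (d + 1), Summable fun m : Site (d + 1) => lamCoeffOf A N κ s l (translate M (t - unitVec l) m) :=
    fun l => summable_lamCoeffOf_translate M hA hC hδ N κ s l _
  have hs₂ : ∀ l : Fin (d + 1), Summable fun m : Site (d + 1) => lamCoeffOf A N κ s l (translate M t m) :=
    fun l => summable_lamCoeffOf_translate M hA hC hδ N κ s l _
  have htr : ∀ (l : Fin (d + 1)) (m : Site (d + 1)), translate M (t - unitVec l) m = translate M t m - unitVec l := fun l m => by
    funext i; simp only [translate_apply, Pi.sub_apply]; ring
  calc ∑ l : Fin (d + 1), ((∑' m : Site (d + 1), lamCoeffOf A N κ s l (translate M (t - unitVec l) m))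
          - ∑' m : Site (d + 1), lamCoeffOf A N κ s l (translate M t m))
      = ∑ l : Fin (d + 1), ∑' m : Site (d + 1),
          (lamCoeffOf A N κ s l (translate M t m - unitVec l) - lamCoeffOf A N κ s l (translate M t m)) := by
        refine Finset.sum_congr rfl fun l _ => ?_
        rw [← (hs₁ l).tsum_sub (hs₂ l)]
        exact tsum_congr fun m => by rw [htr]
    _ = ∑' m : Site (d + 1), ∑ l : Fin (d + 1),
          (lamCoeffOf A N κ s l (translate M t m - unitVec l) - lamCoeffOf A N κ s l (translate M t m)) := by
        rw [Summable.tsum_finsetSum fun l _ => ?_]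
        exact ((hs₁ l).congr fun m => by rw [htr]).sub (hs₂ l)
    _ = 0 := by
        rw [tsum_congr fun m => sum_lamCoeffOf_div_eq_zero A N κ s (translate M t m)]
        exact tsum_zero

end Fold

/-! ## §2 The torus gradient against a gauge function; the finite summation by parts; the identity -/

section Torus

variable (M : Fin (d + 1) → ℕ) [∀ μ, NeZero (M μ)]

/-- [folklore] **the torus gradient column against a gauge function** is the lattice gradient of its periodic extension:
`Σ_t tgrad M (y, inl l) t · λ t = λ (wrapPt M (y + e_l)) − λ (wrapPt M y)` (`tgrad_inl`, `sum_tdelta_mul`). -/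
theorem sum_tgrad_mul_eq_sub (lam : ↥(pbox M) → ℝ) (y : ↥(pbox M)) (l : Fin (d + 1)) :
    ∑ t : ↥(pbox M), tgrad M (y, Sum.inl l) t * lam t
      = lam (wrapPt M ((y : Site (d + 1)) + unitVec l)) - lam (wrapPt M (y : Site (d + 1))) := by
  simp only [tgrad_inl, sub_mul, Finset.sum_sub_distrib, sum_tdelta_mul]

/-- [folklore] **re-indexing the finite torus by a unit shift**: `Σ_{y : pbox M} [wrapPt M (y + e) = t] · f y = f (wrapPt M (t − e))` — the unique box point whose
shifted representative is `t` is the representative of `t − e` (`wrap_wrap_add`, `wrap_eq_self`). -/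
theorem sum_pbox_ite_wrapPt_add_eq (f : ↥(pbox M) → ℝ) (e : Site (d + 1)) (t : ↥(pbox M)) :
    ∑ y : ↥(pbox M), (if wrapPt M ((y : Site (d + 1)) + e) = t then f y else 0) = f (wrapPt M ((t : Site (d + 1)) - e)) := by
  have hkey : ∀ y : ↥(pbox M), wrapPt M ((y : Site (d + 1)) + e) = t ↔ y = wrapPt M ((t : Site (d + 1)) - e) := by
    intro y
    constructor
    · intro h
      apply Subtype.ext
      have h' : wrap M ((y : Site (d + 1)) + e) = (t : Site (d + 1)) := by rw [← wrapPt_coe M, h]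
      rw [wrapPt_coe, ← h', sub_eq_add_neg, wrap_wrap_add, add_neg_cancel_right, wrap_eq_self y.2]
    · intro h
      subst h
      apply Subtype.ext
      rw [wrapPt_coe, wrapPt_coe, wrap_wrap_add, sub_add_cancel, wrap_eq_self t.2]
  rw [Finset.sum_eq_single (wrapPt M ((t : Site (d + 1)) - e))]
  · rw [if_pos ((hkey _).2 rfl)]
  · intro y _ hy
    rw [if_neg (fun h => hy ((hkey y).1 h))]
  · intro h
    exact absurd (Finset.mem_univ _) h

variable {A : MKer (d + 1) (Fib d)} {C δ : ℝ} (hA : Decays A C δ) (hC : 0 ≤ C) (hδ : 0 < δ) (N : ℕ) (κ : Fin (d + 1)) (s : Site (d + 1))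
include hA hC hδ

/-- [folklore] **`sum_tgrad_mul_periodisedLamFold_eq_zero` — THE INDEX-PERIODISED Λ-FOLD KILLS EVERY TORUS PURE GAUGE** ((J-Λ-X), torus letter):
`Σ_{b : pbox M × Fin (d+1)} (Σ_t tgrad M (b.1, inl b.2) t · λ t) · (Σ'_m lamCoeffOf A N κ s b.2 (translate M b.1 m)) = 0` for every decaying `A`, every box,
every gauge function `λ`, every multiplier slot `(κ, s)` — summation by parts on the torus (`sum_tgrad_mul_eq_sub`, `sum_pbox_ite_wrapPt_add_eq`, the fold's
`wrap`-blindness) followed by the zero fine divergence `sum_tsum_lamCoeffOf_translate_div_eq_zero`. -/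
theorem sum_tgrad_mul_periodisedLamFold_eq_zero (lam : ↥(pbox M) → ℝ) :
    ∑ b : ↥(pbox M) × Fin (d + 1),
        (∑ t : ↥(pbox M), tgrad M (b.1, Sum.inl b.2) t * lam t)
          * (∑' m : Site (d + 1), lamCoeffOf A N κ s b.2 (translate M (b.1 : Site (d + 1)) m)) = 0 := by
  -- abbreviate the fold by a function `F l x := Σ'_m lamCoeffOf … l (translate M x m)`; it is `wrap`-blind
  set F : Fin (d + 1) → Site (d + 1) → ℝ := fun l x => ∑' m : Site (d + 1), lamCoeffOf A N κ s l (translate M x m) with hF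
  have hFw : ∀ (l : Fin (d + 1)) (x : Site (d + 1)), F l (wrap M x) = F l x := fun l x => tsum_lamCoeffOf_translate_wrap M N κ s l x
  -- summation by parts: Σ_{y,l} (λ(wrapPt (y+e_l)) − λ(y)) F l y = Σ_t λ t · Σ_l (F l (t − e_l) − F l t)
  have hparts : ∑ b : ↥(pbox M) × Fin (d + 1),
        (∑ t : ↥(pbox M), tgrad M (b.1, Sum.inl b.2) t * lam t) * F b.2 (b.1 : Site (d + 1))
      = ∑ t : ↥(pbox M), lam t * ∑ l : Fin (d + 1), (F l ((t : Site (d + 1)) - unitVec l) - F l (t : Site (d + 1))) := by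
    -- expand the gradient against `λ` as a sum of indicators and exchange the finite sums
    have h1 : ∀ b : ↥(pbox M) × Fin (d + 1), (∑ t : ↥(pbox M), tgrad M (b.1, Sum.inl b.2) t * lam t) * F b.2 (b.1 : Site (d + 1))
        = ∑ t : ↥(pbox M), lam t * ((if wrapPt M ((b.1 : Site (d + 1)) + unitVec b.2) = t then F b.2 (b.1 : Site (d + 1)) else 0)
            - (if b.1 = t then F b.2 (b.1 : Site (d + 1)) else 0)) := fun b => by
      rw [Finset.sum_mul]
      refine Finset.sum_congr rfl fun t _ => ?_
      rw [tgrad_inl, TorusGaugeCovariancePairing.tdelta_eq_ite_wrapPt, TorusGaugeCovariancePairing.tdelta_eq_ite_wrapPt, wrapPt_of_mem]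
      split_ifs <;> ring
    rw [Finset.sum_congr rfl fun b _ => h1 b, Finset.sum_comm]
    refine Finset.sum_congr rfl fun t _ => ?_
    rw [← Finset.mul_sum, Fintype.sum_prod_type_right]
    congr 1
    refine Finset.sum_congr rfl fun l _ => ?_
    rw [Finset.sum_sub_distrib, sum_pbox_ite_wrapPt_add_eq M (fun y : ↥(pbox M) => F l (y : Site (d + 1))) (unitVec l) t,
      Finset.sum_ite_eq' Finset.univ t (fun y : ↥(pbox M) => F l (y : Site (d + 1)))]
    simp only [Finset.mem_univ, if_true, wrapPt_coe, hFw]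
  rw [hparts]
  refine Finset.sum_eq_zero fun t _ => ?_
  rw [show (∑ l : Fin (d + 1), (F l ((t : Site (d + 1)) - unitVec l) - F l (t : Site (d + 1)))) = 0 from
    sum_tsum_lamCoeffOf_translate_div_eq_zero M hA hC hδ N κ s (t : Site (d + 1)), mul_zero]

end Torus

end Summit.QuantumFields.BalabanUV.Beta.FP.PeriodisedLamFoldPureGauge

end
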